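import Literature.MathematicalPhysics.QuantumFieldTheory.Balaban1983to89.B5Eq129FreeResolventZoneSumLetters
import Literature.MathematicalPhysics.QuantumFieldTheory.Balaban1983to89.B5Eq129FreeResolventSupBoundSites

/-!
# `Balaban1983to89.B5Eq129FreeResolventZoneSumSites` — T. Bałaban, *Propagators for lattice gauge theories in a background field*, Commun. Math. Phys. **99** (1985)
# 389–434 [Balaban1985BackgroundPropagators] Thm 3.1 (3.42) p. 397, (3.23) p. 394, (3.11) p. 392, with [Balaban1984PropagatorsI] (1.29)∕(1.31) p. 23: **THE `hFS`
# BINDER OF THE SUP-NORM BOOTSTRAP ON THE CHAIN's SITE LATTICE `TSite d P`, LEVEL-FREE — (FS-b)'s `hFS_tor`∕`hFS_tor_diag` carried along the OWNER's transport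
# `B5Eq129FreeResolventSupBoundSites.fs_tsite_of_tor_sumElim`: in the `Σ_{j : Fin d ⊕ Fin d}`∕`Sum.elim (unshift · x) (shift · x)` shape with weight
# `fun _ => c₀`, general mass (`C₃ = √((m^{4−d})⁻¹c₀⁻¹Π_ν((mP_ν)⁻¹ + π∕(4t√m)))`) and at the diagonal unit mass (`t ≤ P_ν`, `c₀t^d = c₁`: `C₃ = √(3^d∕c₁)`)**

statement-level skeleton of published theorems with citation tags; proofs where landed; nothing here is a claim about the Yang–Mills mass gap

CITATION HEADER (lean-in-tree rule).  Audit cell `pub-balaban`, sub-cell `t4`, BINDER row NE9; filed by NE9 formalisation-swarm LEAF PROVER 02 (lineage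
`b2b-balaban-t4-ne9-formalise-leaf-02`, gen 70) as the JUNCTION of its (FS-b) `B5Eq129FreeResolventZoneSum` with the row OWNER `t4-ne9-p1` g89's (FS-t)
`B5Eq129FreeResolventSupBoundSites` (plan v10 «THE SUP-NORM PROGRAMME», journal [NE9P1-G89-STAGED45]: *«fs_tsite_of_tor∕fs_tsite_of_tor_sumElim — ANY (FS)
letter (any constant C) proved on b05's Tor P with x ± unitVec ν transports to the chain's TSite d P … LITERALLY the hFS binder of norm_le_of_kato_bootstrap at
ι = TSite d P, c = fun _ => c₀»*).  Print loci as in the two imports (read first-hand there and in this lineage's GAPS § C-ne9leaf02g70-1∕-5∕-6): [B9] p. 397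
Thm 3.1 (3.42) (the VALUE row in the sup norms (3.39)), p. 394 (3.23) `Δ^η_U = D*_U D_U`, p. 392 (3.11) the `η^d`-weights; [B5] (1.29)∕(1.31) p. 23 the dual
torus and the symbol.  The `[cite: …]` tags are TEXT LOCATIONS only; every statement is `[folklore]` composition BY NAME (ABSOLUTE RULE: nothing is minted as a
cited fact; nothing of [B9]'s random-walk proof of Thm 3.1 is reproduced).

WHAT IS PROVED (sorry-free; 0 `def`; two one-line compositions).
* **`hFS_tsite`** — any `d ≤ 4`, any `P`, `0 < t`, `0 < m`, `0 < c₀`: the `hFS` binder on `TSite d P` with `C₃ = √((m^{4−d})⁻¹·c₀⁻¹·Π_ν((m·P_ν)⁻¹ + π∕(4t√m)))`.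
* **`hFS_tsite_diag`** — `d ≤ 4`, `t ≤ P_ν` for all `ν`, `c₀·t^d = c₁`, mass `1`: the `hFS` binder on `TSite d P` with `C₃ = √(3^d∕c₁)` — at `P = towerP L m (n+1)`,
  `t = η⁻¹ = L^{n+1}` this is the `hFS` of `B9Eq342GreenPrime(Tower)SupBound.norm_GpOfU(k)_apply_le` with a LEVEL-FREE, VOLUME-FREE constant.
HONEST SCOPE.  Composition only; FREE scalar Laplacian; nothing of [B9] asserted or valued.  NOT summit progress (cell pub-balaban: NE9 NOT PRINTED ∕ NOT PROVED;
«NE9 ⇐ the named binders»; row WALLED ON A MODEL (O-NE9-1; #5 UNRULED); spine PROVED 0∕9; rung (B)+1 finite T⁴ — NOT infinite volume, NOT mass gap, NOT BetaPertH,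
NOT Clay).  HONEST DEPENDENCY (cell line): continuum YM on T⁴ ⇐ BetaPertH ∧ nine spine estimates (0/9 proved); BetaPertH ⇐ (D1) ∧ (D4) ∧ CAP+tail; G-an2-4
gates asym, D1 and NE2/3/4.  NEW file importing `B5Eq129FreeResolventZoneSumLetters` + `B5Eq129FreeResolventSupBoundSites` only; nothing modified.  Net new unproved facts: 0.
-/

noncomputable section

open scoped BigOperators

namespace Literature.MathematicalPhysics.QuantumFieldTheory.Balaban1983to89.B5Eq129FreeResolventZoneSumSites

open B4Sect5Torus (TSite)
open B9SectCLatticeCarrier (shift unshift)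
open B5Prop11Plancherel (Tor)
open B5Eq129FreeResolventZoneSumLetters (hFS_tor hFS_tor_diag)
open B5Eq129FreeResolventSupBoundSites (fs_tsite_of_tor_sumElim)

variable {d : ℕ} (P : Fin d → ℕ) [∀ i, NeZero (P i)]

/-- **THE `hFS` BINDER ON `TSite d P`, GENERAL MASS, LEVEL-FREE CONSTANT** (`d ≤ 4`): for `ψ ≥ 0`, `φ₁`, `φ₂ : TSite d P → ℝ` with
`Σ_{j : Fin d ⊕ Fin d} t²(φ₁ x − φ₁(Sum.elim (unshift · x) (shift · x) j)) + mφ₁ x = ψ x` and the same from `φ₂` to `φ₁`: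
`φ₂ x ≤ √((m^{4−d})⁻¹·c₀⁻¹·Π_ν((m·P_ν)⁻¹ + π∕(4t√m))) · √(Σ_y c₀ψ y²)`. [cite: Balaban1985BackgroundPropagators, Thm 3.1 (3.42) p.397, (3.23) p.394, (3.11) p.392] -/
theorem hFS_tsite (hd : d ≤ 4) {t m c₀ : ℝ} (ht : 0 < t) (hm : 0 < m) (hc₀ : 0 < c₀) :
    ∀ ψ φ₁ φ₂ : TSite d P → ℝ, (∀ x, 0 ≤ ψ x) →
      (∀ x, ∑ j : Fin d ⊕ Fin d, t ^ 2 * (φ₁ x - φ₁ (Sum.elim (fun μ => unshift μ x) (fun μ => shift μ x) j)) + m * φ₁ x = ψ x) →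
      (∀ x, ∑ j : Fin d ⊕ Fin d, t ^ 2 * (φ₂ x - φ₂ (Sum.elim (fun μ => unshift μ x) (fun μ => shift μ x) j)) + m * φ₂ x = φ₁ x) →
      ∀ x, φ₂ x ≤ Real.sqrt ((m ^ (4 - d))⁻¹ * c₀⁻¹ * ∏ ν, ((m * (P ν : ℝ))⁻¹ + Real.pi / (4 * t * Real.sqrt m))) *
        Real.sqrt (∑ y, (fun _ : TSite d P => c₀) y * ψ y ^ 2) :=
  fs_tsite_of_tor_sumElim P (hFS_tor P hd ht hm hc₀)

/-- **THE `hFS` BINDER ON `TSite d P` AT THE DIAGONAL, UNIT MASS: `C₃ = √(3^d∕c₁)`** (`d ≤ 4`, `t ≤ P_ν`, `c₀·t^d = c₁`) — for the chain's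
`P = towerP L m (n+1)`, `t = η⁻¹ = L^{n+1}` (so `t ^ 2` is the `(η⁻¹) ^ 2` of `norm_GpOfUk_apply_le`'s `hFS`), LEVEL-FREE and VOLUME-FREE.
[cite: Balaban1985BackgroundPropagators, Thm 3.1 (3.42) p.397, (3.23) p.394, (3.11) p.392] -/
theorem hFS_tsite_diag (hd : d ≤ 4) {t c₀ c₁ : ℝ} (ht : 0 < t) (hc₀ : 0 < c₀) (hc₁ : c₀ * t ^ d = c₁) (hvol : ∀ ν, t ≤ (P ν : ℝ)) :
    ∀ ψ φ₁ φ₂ : TSite d P → ℝ, (∀ x, 0 ≤ ψ x) →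
      (∀ x, ∑ j : Fin d ⊕ Fin d, t ^ 2 * (φ₁ x - φ₁ (Sum.elim (fun μ => unshift μ x) (fun μ => shift μ x) j)) + 1 * φ₁ x = ψ x) →
      (∀ x, ∑ j : Fin d ⊕ Fin d, t ^ 2 * (φ₂ x - φ₂ (Sum.elim (fun μ => unshift μ x) (fun μ => shift μ x) j)) + 1 * φ₂ x = φ₁ x) →
      ∀ x, φ₂ x ≤ Real.sqrt (3 ^ d / c₁) * Real.sqrt (∑ y, (fun _ : TSite d P => c₀) y * ψ y ^ 2) :=
  fs_tsite_of_tor_sumElim P (hFS_tor_diag P hd ht hc₀ hc₁ hvol)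

end Literature.MathematicalPhysics.QuantumFieldTheory.Balaban1983to89.B5Eq129FreeResolventZoneSumSites

end
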